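import Mathlib
import HarnessLib

/-!
# Crux `Persistence` (stmt-ResolutionOfSingularities-16484), chain W4.4b — K-C3 K4a/b: the WITNESS
# `X_b` at the vertex of `𝔸³/μ₆(1,2,3)` — `a⁶` does NOT stably annihilate it (hand certificate)

Route `ResolutionOfSingularities/HomologicalConductor`.  OURS (cell res-hironaka, crux chain W4.4b,
KILL CANDIDATE K-C3, planner res-L1-w44b-plan-1's `L/w44b/kc3/K-C3-REPRO.md` 40352614fdfe8abf §3 /
§4 / §7, CHAIN v13.3 ASSIGN v1.9 «058: K4a/b»; seat res-D-pv-058); nothing here is a statement of the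
manuscript under review (Hironaka 2017); AI-written, weaker than expert review.

`W = k[a,b,c]^{μ₆(1,2,3)} = k[a⁶, a⁴b, a³c, a²b², abc, c², b³]`; the `W`-module
`X_b := coker (S₁ → S₃ ⊕ W⁵)` (MCM of rank 5) has the presentation `W¹² —∂→ W⁸ → X_b → 0` whose
matrix `D = kc3D` (8 generators `g0…g7` = rows, 12 relations `r0…r11` = columns, all entries
monomials of `k[a,b,c]`, `a = X 0`, `b = X 1`, `c = X 2`) is typed below VERBATIM from §3.  By the
sandwich criterion (sibling `PersistenceFaithfullyFlatDescent.exists_comp_eq_smul_id_iff_exists_sandwich`,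
matrix form `PersistenceStableAnnihilatorMatrix.…`) `c ∈ s-ann(coker ∂) ⟺ ∃ E, ∂ E ∂ = −c ∂`.

* `kc3D` — the 8 × 12 matrix `∂` (§3); `kc3Λ` — the certificate functional
  `Λ(M) = −coeff_{a¹⁰b}(M 2 9) + coeff_{a⁷bc}(M 3 11) + coeff_{a⁶}(M 1 11)` (§4);
* **`kc3Λ_mul_mul` (K4a): `Λ (D * E * D) = 0` for EVERY `E : Matrix (Fin 12) (Fin 8) k[a,b,c]`** —
  only four slots of `E` reach the three coefficients and they cancel in pairs (`e1: +1 −1`,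
  `e2: −1 +1`, `e3: +1 −1`);
* **`kc3Λ_smul` (K4b): `Λ ((s * a⁶) • D) = s(0)`**;
* **`not_exists_certificate`: `s(0) ≠ 0 ⇒ ¬ ∃ E, D * E * D = −((s * a⁶) • D)`** — over EVERY commutative
  ring `k` (all coefficients `±1`): no certificate for `s·a⁶` with `s(0) ≠ 0`, i.e. (after clearing the
  denominators of `T₁ = W_𝔪`, K4c) `a⁶ ∉ s-ann_{T₁}(X_b ⊗ T₁)`, hence — with `X_b` MCM and `W_𝔪`
  Gorenstein (Esentepe 2020 L2.3) — `a⁶ ∉ ca(T₁)`: condition (α) of K-C3.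

[OURS; elementary coefficient bookkeeping; the mathematics (witness and certificate) is the planner's
K-C3-REPRO, reproduced independently of tri-2 / stub-1 / repro-2 / idea-1.]
-/

noncomputable section

-- single-problem summit: the doubled namespace component `ResolutionOfSingularities` is forced
set_option linter.dupNamespace false

open MvPolynomial

universe u

namespace Summit.ResolutionOfSingularities.ResolutionOfSingularities.Theorems.HomologicalConductor.KC3Witness

variable (k : Type u) [CommRing k]

/-! ## Exponent vectors and one coefficient lemma -/

/-- The exponent vector of `a^p b^q c^r`. [OURS · bookkeeping] -/
def e (p q r : ℕ) : Fin 3 →₀ ℕ := Finsupp.single 0 p + Finsupp.single 1 q + Finsupp.single 2 r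

variable {k}

/-- The `a`-exponent. [OURS · bookkeeping] -/
@[simp] theorem e_apply_zero (p q r : ℕ) : e p q r 0 = p := by simp [e]

/-- The `b`-exponent. [OURS · bookkeeping] -/
@[simp] theorem e_apply_one (p q r : ℕ) : e p q r 1 = q := by simp [e]

/-- The `c`-exponent. [OURS · bookkeeping] -/
@[simp] theorem e_apply_two (p q r : ℕ) : e p q r 2 = r := by simp [e]

/-- Comparison of exponent vectors is componentwise. [folklore] -/
theorem e_le_iff (p q r i j l : ℕ) : e p q r ≤ e i j l ↔ p ≤ i ∧ q ≤ j ∧ r ≤ l := by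
  constructor
  · intro h
    exact ⟨by simpa using h 0, by simpa using h 1, by simpa using h 2⟩
  · rintro ⟨h0, h1, h2⟩ x
    fin_cases x <;> simpa

/-- Sum of exponent vectors. [folklore] -/
theorem e_add (p q r p' q' r' : ℕ) : e p q r + e p' q' r' = e (p + p') (q + q') (r + r') := by
  ext x; fin_cases x <;> simp

/-- Difference of exponent vectors. [folklore] -/
theorem e_sub (i j l p q r : ℕ) : e i j l - e p q r = e (i - p) (j - q) (l - r) := by
  ext x; fin_cases x <;> simp

/-- `e 0 0 0 = 0`. [folklore] -/
theorem e_zero : e 0 0 0 = 0 := by ext x; fin_cases x <;> simp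

/-- **The coefficient lemma**: the `a^i b^j c^l`-coefficient of `(u·mono) * P * (u'·mono')` is
`u u' ·` the shifted coefficient of `P` if the monomials divide, else `0`. [folklore] -/
theorem coeff_monomial_mul_mul_monomial (i j l p q r p' q' r' : ℕ) (u u' : k)
    (P : MvPolynomial (Fin 3) k) :
    coeff (e i j l) (monomial (e p q r) u * P * monomial (e p' q' r') u') =
      if p + p' ≤ i ∧ q + q' ≤ j ∧ r + r' ≤ l then
        u * u' * coeff (e (i - (p + p')) (j - (q + q')) (l - (r + r'))) P else 0 := by
  rw [mul_right_comm, monomial_mul, e_add, coeff_monomial_mul', e_sub]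
  by_cases h : p + p' ≤ i ∧ q + q' ≤ j ∧ r + r' ≤ l
  · rw [if_pos ((e_le_iff _ _ _ _ _ _).mpr h), if_pos h]
  · rw [if_neg (fun h' => h ((e_le_iff _ _ _ _ _ _).mp h')), if_neg h]

/-- The same with the left monomial only (`mono * P`). [folklore] -/
theorem coeff_monomial_mul_e (i j l p q r : ℕ) (u : k) (P : MvPolynomial (Fin 3) k) :
    coeff (e i j l) (monomial (e p q r) u * P) =
      if p ≤ i ∧ q ≤ j ∧ r ≤ l then u * coeff (e (i - p) (j - q) (l - r)) P else 0 := by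
  rw [coeff_monomial_mul', e_sub]
  by_cases h : p ≤ i ∧ q ≤ j ∧ r ≤ l
  · rw [if_pos ((e_le_iff _ _ _ _ _ _).mpr h), if_pos h]
  · rw [if_neg (fun h' => h ((e_le_iff _ _ _ _ _ _).mp h')), if_neg h]

/-- The same with the right monomial only (`P * mono`). [folklore] -/
theorem coeff_mul_monomial_e (i j l p q r : ℕ) (u : k) (P : MvPolynomial (Fin 3) k) :
    coeff (e i j l) (P * monomial (e p q r) u) =
      if p ≤ i ∧ q ≤ j ∧ r ≤ l then u * coeff (e (i - p) (j - q) (l - r)) P else 0 := by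
  rw [mul_comm, coeff_monomial_mul_e]

variable (k)

/-! ## The presentation matrix `∂` of `X_b` (K-C3-REPRO §3) -/

/-- **`∂ : W¹² → W⁸`**, the presentation of `X_b = coker(S₁ → S₃ ⊕ W⁵)`: rows = generators
`g0 = [c], g1 = [ab], g2 = [a³], g3 = e_{bc}, g4 = e_{ab²}, g5 = e_{a²c}, g6 = e_{a³b}, g7 = e_{a⁵}`;
columns = relations `r0…r9` (binomial syzygies of `(c, ab, a³)` in `S₃`), `r10`, `r11` (images of
`b²c`, `a ∈ S₁`).  Entries in `k[a,b,c] = MvPolynomial (Fin 3) k`. [OURS · K-C3-REPRO §3 verbatim] -/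
def kc3D : Matrix (Fin 8) (Fin 12) (MvPolynomial (Fin 3) k) :=
  Matrix.of ![
    ![monomial (e 1 1 1) 1, monomial (e 2 2 0) 1, monomial (e 4 1 0) 1, monomial (e 3 0 1) 1,
      monomial (e 4 1 0) 1, monomial (e 6 0 0) 1, 0, 0, 0, 0, monomial (e 0 3 0) (-1), 0],
    ![monomial (e 0 0 2) (-1), monomial (e 1 1 1) (-1), monomial (e 3 0 1) (-1), 0, 0, 0,
      monomial (e 2 2 0) 1, monomial (e 3 0 1) 1, monomial (e 4 1 0) 1, monomial (e 6 0 0) 1, 0,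
      monomial (e 0 0 0) (-1)],
    ![0, 0, 0, monomial (e 0 0 2) (-1), monomial (e 1 1 1) (-1), monomial (e 3 0 1) (-1),
      monomial (e 0 3 0) (-1), monomial (e 1 1 1) (-1), monomial (e 2 2 0) (-1),
      monomial (e 4 1 0) (-1), 0, 0],
    ![0, 0, 0, 0, 0, 0, 0, 0, 0, 0, monomial (e 0 3 2) 1, monomial (e 1 1 1) 1],
    ![0, 0, 0, 0, 0, 0, 0, 0, 0, 0, monomial (e 1 4 1) 1, monomial (e 2 2 0) 1],
    ![0, 0, 0, 0, 0, 0, 0, 0, 0, 0, monomial (e 2 2 2) 1, monomial (e 3 0 1) 1],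
    ![0, 0, 0, 0, 0, 0, 0, 0, 0, 0, monomial (e 3 3 1) 1, monomial (e 4 1 0) 1],
    ![0, 0, 0, 0, 0, 0, 0, 0, 0, 0, monomial (e 5 2 1) 1, monomial (e 6 0 0) 1]]

/-- **The certificate functional** `Λ(M) = −coeff_{a¹⁰b}(M 2 9) + coeff_{a⁷bc}(M 3 11) + coeff_{a⁶}(M 1 11)`.
[OURS · K-C3-REPRO §4] -/
def kc3Λ (M : Matrix (Fin 8) (Fin 12) (MvPolynomial (Fin 3) k)) : k :=
  -coeff (e 10 1 0) (M 2 9) + coeff (e 7 1 1) (M 3 11) + coeff (e 6 0 0) (M 1 11)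

variable {k}

/-- `Λ` is compatible with negation. [folklore] -/
theorem kc3Λ_neg (M : Matrix (Fin 8) (Fin 12) (MvPolynomial (Fin 3) k)) : kc3Λ k (-M) = -kc3Λ k M := by
  simp only [kc3Λ, Matrix.neg_apply, coeff_neg]
  ring

/-- Triple products, entrywise: `(D E D) g r = Σ_{r'} Σ_{g'} D g r' · E r' g' · D g' r`. [folklore] -/
theorem mul_mul_apply (E : Matrix (Fin 12) (Fin 8) (MvPolynomial (Fin 3) k)) (g : Fin 8) (r : Fin 12) :
    (kc3D k * E * kc3D k) g r = ∑ r', ∑ g', kc3D k g r' * E r' g' * kc3D k g' r := by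
  rw [Matrix.mul_apply]
  simp only [Matrix.mul_apply, Finset.sum_mul]
  rw [Finset.sum_comm]

/-! ## K4a: `Λ (∂ E ∂) = 0` for every `E` -/

/-- The `a⁶`-coefficient of `(∂E∂)_{g1,r11}` is `−e1 + e2 − e3`. [OURS · K-C3-REPRO §4] -/
theorem coeff_slot_1_11 (E : Matrix (Fin 12) (Fin 8) (MvPolynomial (Fin 3) k)) :
    coeff (e 6 0 0) ((kc3D k * E * kc3D k) 1 11) =
      -coeff (e 0 0 0) (E 9 1) + coeff (e 6 0 0) (E 11 1) - coeff (e 0 0 0) (E 11 7) := by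
  rw [mul_mul_apply]
  simp [kc3D, Fin.sum_univ_succ, coeff_monomial_mul_e, coeff_mul_monomial_e]
  ring

/-- The `a¹⁰b`-coefficient of `(∂E∂)_{g2,r9}` is `−e1`. [OURS · K-C3-REPRO §4] -/
theorem coeff_slot_2_9 (E : Matrix (Fin 12) (Fin 8) (MvPolynomial (Fin 3) k)) :
    coeff (e 10 1 0) ((kc3D k * E * kc3D k) 2 9) = -coeff (e 0 0 0) (E 9 1) := by
  rw [mul_mul_apply]
  simp [kc3D, Fin.sum_univ_succ, coeff_monomial_mul_e, coeff_mul_monomial_e]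

/-- The `a⁷bc`-coefficient of `(∂E∂)_{g3,r11}` is `−e2 + e3`. [OURS · K-C3-REPRO §4] -/
theorem coeff_slot_3_11 (E : Matrix (Fin 12) (Fin 8) (MvPolynomial (Fin 3) k)) :
    coeff (e 7 1 1) ((kc3D k * E * kc3D k) 3 11) =
      -coeff (e 6 0 0) (E 11 1) + coeff (e 0 0 0) (E 11 7) := by
  rw [mul_mul_apply]
  simp [kc3D, Fin.sum_univ_succ, coeff_monomial_mul_e, coeff_mul_monomial_e]

/-- **K4a.** `Λ (∂ E ∂) = 0` for EVERY `E : W⁸ → W¹²` with entries in `k[a,b,c]` (a fortiori in `W`),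
over every commutative ring `k`. [OURS · K-C3-REPRO §4] -/
theorem kc3Λ_mul_mul (E : Matrix (Fin 12) (Fin 8) (MvPolynomial (Fin 3) k)) :
    kc3Λ k (kc3D k * E * kc3D k) = 0 := by
  rw [kc3Λ, coeff_slot_1_11, coeff_slot_2_9, coeff_slot_3_11]
  ring

/-! ## K4b: `Λ ((s·a⁶) • ∂) = s(0)` -/

/-- **K4b.** `Λ ((s · a⁶) • ∂) = coeff₀ s` for every `s ∈ k[a,b,c]` (the three entries of `∂` met by
`Λ` are `−a⁴b`, `abc`, `−1`). [OURS · K-C3-REPRO §4] -/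
theorem kc3Λ_smul (s : MvPolynomial (Fin 3) k) :
    kc3Λ k ((s * X 0 ^ 6) • kc3D k) = coeff 0 s := by
  have he : e 6 0 0 = Finsupp.single 0 6 := by ext x; fin_cases x <;> simp
  have hX : (X 0 ^ 6 : MvPolynomial (Fin 3) k) = monomial (e 6 0 0) 1 := by
    rw [he, X_pow_eq_monomial]
  simp only [kc3Λ, Matrix.smul_apply, smul_eq_mul, hX]
  simp [kc3D, mul_assoc, mul_comm s, coeff_monomial_mul_e, e_zero]

/-! ## The certificate -/

/-- **K-C3 K4 (no certificate).**  For every commutative ring `k` and every `s ∈ k[a,b,c]` with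
`s(0) ≠ 0` there are NO `E : Matrix (Fin 12) (Fin 8) k[a,b,c]` with `∂ E ∂ = −(s·a⁶) ∂`.  By the
sandwich criterion this says: `s·a⁶` does not stably annihilate `coker ∂ = X_b` over `k[a,b,c]`-valued
data, and after clearing denominators (`s(0) ≠ 0` = `s` a unit of `W_𝔪`) `a⁶ ∉ s-ann_{W_𝔪}(X_b ⊗ W_𝔪)`
(K4c). [OURS · K-C3-REPRO §4/§7] -/
theorem not_exists_certificate (s : MvPolynomial (Fin 3) k) (hs : coeff 0 s ≠ 0) :
    ¬ ∃ E : Matrix (Fin 12) (Fin 8) (MvPolynomial (Fin 3) k),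
      kc3D k * E * kc3D k = -((s * X 0 ^ 6) • kc3D k) := by
  rintro ⟨E, hE⟩
  have h := congrArg (kc3Λ k) hE
  rw [kc3Λ_mul_mul, kc3Λ_neg, kc3Λ_smul] at h
  exact hs (neg_eq_zero.mp h.symm)

/-- The special case `s = 1`: no `E` with `∂ E ∂ = −a⁶ ∂`, i.e. `a⁶` itself admits no certificate
over `k[a,b,c]` (`k` nontrivial). [OURS] -/
theorem not_exists_certificate_one [Nontrivial k] :
    ¬ ∃ E : Matrix (Fin 12) (Fin 8) (MvPolynomial (Fin 3) k),
      kc3D k * E * kc3D k = -((X 0 ^ 6 : MvPolynomial (Fin 3) k) • kc3D k) := by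
  have h := not_exists_certificate (k := k) 1 (by simp)
  simpa using h

end Summit.ResolutionOfSingularities.ResolutionOfSingularities.Theorems.HomologicalConductor.KC3Witness
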